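import Literature.Geometry.Lorentzian.CauchyHypersurfaceGlobalHyperbolicity
import Literature.Geometry.Lorentzian.CausalFutureCompactSet
import Literature.Geometry.Lorentzian.IPlusRegular
import HarnessLib

/-!
# Causally convex regions, time functions on a region, the achronal core, the past Cauchy horizon

Elementary causality bookkeeping over the tree's causal API (`causalFuture`, `chronologicalFuture`,
`IsFutureCausalCurveOn`, `pastCauchyDevelopment`, push-up `J⁺ ∘ I⁺ ⊆ I⁺`), for a `Cⁿ` time-oriented
Lorentzian metric on a manifold without boundary (Hausdorffness only where stated).  Everything is
proved; the only new NOTIONS are four sets/predicates the tree did not name: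

* §1 `LorentzianMetric.IsCausallyConvex g τ R` — every future causal curve with endpoints in `R`
  stays in `R` (Hawking–Ellis 1973, §6.6; O'Neill 1983, Ch. 14, Def. 14.11), with `univ`, `∩`,
  `J⁺(T)`, `I⁺(T)`, `J⁺(T) ∖ I⁺(T)`, globally hyperbolic sets as examples; and
  `LorentzianMetric.IsTimeFunctionOn g τ t R` — `t` strictly increases along future causal curves in
  `R` (the conclusion of the tree's Geroch theorem `IsGloballyHyperbolicSet.exists_timeFunction`,
  Hawking–Ellis Prop. 6.6.8), with the ACAUSALITY OF LEVEL SETS inside a causally convex region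
  (`IsCausallyConvex.isAcausal_of_subset_level`, O'Neill 1983, Ch. 14, Lemma 14.42-type statement);
* §2 `LorentzianMetric.achronalCore g τ T = T ∖ I⁺(T)` — the points of `T` with no point of `T` in
  their chronological past (`T ∩ E⁺(T)`, the future horismos of Hawking–Ellis §4.5 / O'Neill Ch. 14,
  p. 403): achronal, `= T` iff `T` achronal, compact for compact `T`, non-empty in a chronological
  space-time, and `J⁺(core T) = J⁺(T)`, `I⁺(core T) = I⁺(T)` for compact `T`
  (via the tree's compactness of causal futures, `CausalFutureCompactSet`);
* §3 `LorentzianMetric.pastCauchyHorizon g τ A = closure D⁻(A) ∖ I⁺(D⁻(A))` — the time dual of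
  Hawking–Ellis' `H⁺(S)` (§6.5, definition before Prop. 6.5.2): `J⁺(int D) ⊆ I⁺(D)` for every set
  `D`, hence `J⁺(int D⁻(A)) ∩ H⁻(A) = ∅` (the elementary half of Hawking–Ellis Prop. 6.5.2 /
  Prop. 6.6.3 Cor., `int D(S) = D(S) − (H⁺ ∪ H⁻)`).

Provenance: decomp-fsc lens-4 side files `LevelSetAcausalByTree43.lean` (g43), `AchronalCoreByTree41.lean`
(g41), `SealedCollarByTree40.lean` (g40) — merged into one module as the cell's critic asked
(rows 343/348/357, D-0064), re-homed into `namespace Literature.Geometry.Lorentzian.LorentzianMetric`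
(so `g.IsCausallyConvex τ R`, `g.achronalCore τ T`, `g.pastCauchyHorizon τ A` by dot notation);
statements verbatim, docstrings/cites kept and completed.

NOT here: the route-side uses (collar sealing of the AMMS slab, the exterior-by-tree argument), the
Bernard–Suhr 2020 temporal-function facts (named facts, not typed here), the shell topology of
non-separating hypersurfaces.
-/

noncomputable section

open Set Filter Function
open scoped Manifold ContDiff Topology

namespace Literature.Geometry.Lorentzian

namespace LorentzianMetric

variable {E : Type*} [NormedAddCommGroup E] [NormedSpace ℝ E] {H : Type*} [TopologicalSpace H]
  {I : ModelWithCorners ℝ E H} {n : ℕ∞ω} {M : Type*} [TopologicalSpace M] [ChartedSpace H M]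
  [IsManifold I ∞ M]

/-! ## §1 Causally convex regions and time functions on a region -/

section CausallyConvex

/-- A region `R ⊆ M` is **causally convex** if every future causal curve `γ : [a, b] → M` with
both endpoints in `R` lies in `R` (curve form; for the set form `J⁺(p) ∩ J⁻(q) ⊆ R` see
`isCausallyConvex_of_isGloballyHyperbolicSet`). Hawking–Ellis 1973, §6.6 (p. 206); O'Neill 1983,
Ch. 14, Def. 14.11 (strong causality via causally convex neighbourhoods).
[cite: HawkingEllis1973, §6.6 (p. 206)] -/
def IsCausallyConvex (g : LorentzianMetric I n M) (τ : TimeOrientation g) (R : Set M) : Prop :=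
  ∀ (γ : ℝ → M) (a b : ℝ), a < b → g.IsFutureCausalCurveOn τ γ (Icc a b) → γ a ∈ R → γ b ∈ R →
    ∀ s ∈ Icc a b, γ s ∈ R

/-- `t : M → ℝ` is a **time function on `R`**: strictly increasing along every future causal
curve lying in `R` — the conclusion of the tree's Geroch theorem
`LorentzianMetric.IsGloballyHyperbolicSet.exists_timeFunction` (Hawking–Ellis 1973,
Prop. 6.6.8; a Cauchy time function, Bär–Fredenhagen (eds.) 2009, Ch. 2, Cor. 2, is the case
`R = univ`). [cite: HawkingEllis1973CUP, §6.6, Prop. 6.6.8 (pp. 211–212)] -/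
def IsTimeFunctionOn (g : LorentzianMetric I n M) (τ : TimeOrientation g) (t : M → ℝ)
    (R : Set M) : Prop :=
  ∀ (γ : ℝ → M) (a b : ℝ), a < b → g.IsFutureCausalCurveOn τ γ (Icc a b) →
    (∀ s ∈ Icc a b, γ s ∈ R) → t (γ a) < t (γ b)

variable {g : LorentzianMetric I n M} {τ : TimeOrientation g}

/-- The whole space-time is causally convex. [cite: HawkingEllis1973, §6.6 (p. 206)] -/
theorem isCausallyConvex_univ : IsCausallyConvex g τ (univ : Set M) :=
  fun _ _ _ _ _ _ _ _ _ ↦ mem_univ _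

/-- The intersection of two causally convex regions is causally convex. [cite: HawkingEllis1973, §6.6 (p. 206)] -/
theorem IsCausallyConvex.inter {R R' : Set M} (h : IsCausallyConvex g τ R)
    (h' : IsCausallyConvex g τ R') : IsCausallyConvex g τ (R ∩ R') :=
  fun γ a b hab hγ ha hb s hs ↦ ⟨h γ a b hab hγ ha.1 hb.1 s hs, h' γ a b hab hγ ha.2 hb.2 s hs⟩

/-- A time function on `R` is a time function on every subregion `R' ⊆ R`. [cite: HawkingEllis1973CUP, §6.6, Prop. 6.6.8 (pp. 211–212)] -/
theorem IsTimeFunctionOn.mono {t : M → ℝ} {R R' : Set M} (ht : IsTimeFunctionOn g τ t R)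
    (h : R' ⊆ R) : IsTimeFunctionOn g τ t R' :=
  fun γ a b hab hγ hγR' ↦ ht γ a b hab hγ fun s hs ↦ h (hγR' s hs)

/-- The points of a future causal curve `γ : [a, b] → M` lie in `J⁺(γ a)` (restriction of the
curve). O'Neill 1983, Ch. 14, p. 402. [cite: ONeillSemiRiemannian1983, Ch. 14, p. 402] -/
theorem mem_causalFuture_of_isFutureCausalCurveOn {γ : ℝ → M} {a b : ℝ}
    (hγ : g.IsFutureCausalCurveOn τ γ (Icc a b)) {s : ℝ} (hs : s ∈ Icc a b) :
    γ s ∈ g.causalFuture τ {γ a} := by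
  rcases eq_or_lt_of_le hs.1 with h | h
  · exact Or.inl (by rw [← h]; exact mem_singleton _)
  · exact Or.inr ⟨γ a, mem_singleton _, γ, a, s, h, hγ.mono (Icc_subset_Icc_right hs.2), rfl, rfl⟩

/-- … and `γ b ∈ J⁺(γ s)` for every parameter `s ∈ [a, b]`. O'Neill 1983, Ch. 14, p. 402.
[cite: ONeillSemiRiemannian1983, Ch. 14, p. 402] -/
theorem mem_causalFuture_of_isFutureCausalCurveOn' {γ : ℝ → M} {a b : ℝ}
    (hγ : g.IsFutureCausalCurveOn τ γ (Icc a b)) {s : ℝ} (hs : s ∈ Icc a b) :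
    γ b ∈ g.causalFuture τ {γ s} := by
  rcases eq_or_lt_of_le hs.2 with h | h
  · exact Or.inl (by rw [h]; exact mem_singleton _)
  · exact Or.inr ⟨γ s, mem_singleton _, γ, s, b, h, hγ.mono (Icc_subset_Icc_left hs.1), rfl, rfl⟩

/-- A **future set** (`J⁺(R) ⊆ R`) is causally convex. Hawking–Ellis 1973, §6.3 (future sets).
[cite: HawkingEllis1973, §6.3] -/
theorem isCausallyConvex_of_causalFuture_subset {R : Set M} (hR : g.causalFuture τ R ⊆ R) :
    IsCausallyConvex g τ R :=
  fun _ _ _ _ hγ ha _ _ hs ↦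
    hR (causalFuture_mono (singleton_subset_iff.mpr ha)
      (mem_causalFuture_of_isFutureCausalCurveOn hγ hs))

/-- A **past set** (`J⁻(R) ⊆ R`) is causally convex (time dual). Hawking–Ellis 1973, §6.3.
[cite: HawkingEllis1973, §6.3] -/
theorem isCausallyConvex_of_causalPast_subset {R : Set M} (hR : g.causalPast τ R ⊆ R) :
    IsCausallyConvex g τ R :=
  fun _ _ _ _ hγ _ hb _ hs ↦
    hR (causalFuture_mono (τ := τ.reverse) (singleton_subset_iff.mpr hb)
      (mem_causalPast_singleton_iff.mpr (mem_causalFuture_of_isFutureCausalCurveOn' hγ hs)))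

/-- **`J⁺(T)` is causally convex** (`J⁺ J⁺ = J⁺`, tree `causalFuture_causalFuture_eq`, O'Neill
1983, Ch. 14, p. 402). [cite: ONeillSemiRiemannian1983, Ch. 14, p. 402] -/
theorem isCausallyConvex_causalFuture [BoundarylessManifold I M] (hn : 2 ≤ n) (T : Set M) :
    IsCausallyConvex g τ (g.causalFuture τ T) :=
  isCausallyConvex_of_causalFuture_subset (causalFuture_causalFuture_eq hn T).subset

/-- **`I⁺(T)` is a future set: `J⁺(I⁺(T)) ⊆ I⁺(T)`** (push-up, O'Neill 1983, Ch. 14, Cor. 14.1: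
`p ≪ q ≤ r ⇒ p ≪ r`; set form from the tree's pointwise
`mem_chronologicalFuture_of_mem_chronologicalFuture_of_mem_causalFuture_set`).  g43 addition
(RC-355-1 «SliceSide»). [cite: ONeillSemiRiemannian1983, Ch. 14, Cor. 14.1 (p. 402)] -/
theorem causalFuture_chronologicalFuture_subset [BoundarylessManifold I M]
    [FiniteDimensional ℝ E] (hn : 1 ≤ n) (T : Set M) :
    g.causalFuture τ (g.chronologicalFuture τ T) ⊆ g.chronologicalFuture τ T := by
  rintro q (hq | ⟨p, hp, γ, a, b, hab, hγ, hpa, hqb⟩)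
  · exact hq
  · exact mem_chronologicalFuture_of_mem_chronologicalFuture_of_mem_causalFuture_set hn hp
      (Or.inr ⟨p, mem_singleton p, γ, a, b, hab, hγ, hpa, hqb⟩)

/-- **`I⁺(T)` is causally convex** (a future set, `causalFuture_chronologicalFuture_subset` +
`isCausallyConvex_of_causalFuture_subset`): in particular the open subspacetime `I⁺(Σ)` of a
development, inside which Bernal–Sánchez 2006 Thm 1.1 may be applied to an acausal compact
spacelike `T ⊂ I⁺(Σ)` (critic row 355, RC-355-1).  g43 addition.
[cite: ONeillSemiRiemannian1983, Ch. 14, Cor. 14.1 (p. 402)] -/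
theorem isCausallyConvex_chronologicalFuture [BoundarylessManifold I M] [FiniteDimensional ℝ E]
    (hn : 1 ≤ n) (T : Set M) : IsCausallyConvex g τ (g.chronologicalFuture τ T) :=
  isCausallyConvex_of_causalFuture_subset (causalFuture_chronologicalFuture_subset hn T)

/-- **The future horismos `E⁺(T) = J⁺(T) ∖ I⁺(T)` is causally convex**: a causal curve between
two of its points stays in `J⁺(T)`, and a point of it in `I⁺(T)` would push the endpoint into
`I⁺(T)` (push-up, O'Neill 1983, Ch. 14, Cor. 14.1, tree
`mem_chronologicalFuture_of_mem_chronologicalFuture_of_mem_causalFuture_set`).  With NODE-g41's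
`E⁺(achronalCore T) = E⁺(T)`: the null shell `∂J⁺(T)` region in which lens-4 looks for an
unfolded trapped section is a causally convex region.
[cite: ONeillSemiRiemannian1983, Ch. 14, Cor. 14.1 (p. 402)] -/
theorem isCausallyConvex_causalFuture_diff_chronologicalFuture [BoundarylessManifold I M]
    [FiniteDimensional ℝ E] (hn : 2 ≤ n) (T : Set M) :
    IsCausallyConvex g τ (g.causalFuture τ T \ g.chronologicalFuture τ T) := by
  have hn1 : (1 : ℕ∞ω) ≤ n := le_trans (by norm_num) hn
  intro γ a b hab hγ ha hb s hs
  refine ⟨isCausallyConvex_causalFuture hn T γ a b hab hγ ha.1 hb.1 s hs, fun hsI ↦ hb.2 ?_⟩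
  exact mem_chronologicalFuture_of_mem_chronologicalFuture_of_mem_causalFuture_set hn1 hsI
    (mem_causalFuture_of_isFutureCausalCurveOn' hγ hs)

/-- **A globally hyperbolic set is causally convex** in the curve sense: `γ s ∈ J⁺(γ a) ∩ J⁻(γ b)
⊆ N` by the set-form causal convexity recorded in the tree's
`LorentzianMetric.IsGloballyHyperbolicSet.inter_subset` (Hawking–Ellis 1973, §6.6, p. 206).
[cite: HawkingEllis1973, §6.6 (p. 206)] -/
theorem isCausallyConvex_of_isGloballyHyperbolicSet {N : Set M}
    (hN : g.IsGloballyHyperbolicSet τ N) : IsCausallyConvex g τ N :=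
  fun _ _ _ _ hγ ha hb _ hs ↦ hN.inter_subset ha hb
    ⟨mem_causalFuture_of_isFutureCausalCurveOn hγ hs,
      mem_causalPast_singleton_iff.mpr (mem_causalFuture_of_isFutureCausalCurveOn' hγ hs)⟩

/-- **Level sets of a time function on a causally convex region are acausal.**  If `R` is
causally convex, `t` strictly increases along future causal curves in `R`, and `S ⊆ R` lies in
one level `t⁻¹{c}`, then no future causal curve `γ : [a, b] → M`, `a < b`, runs from a point of
`S` to a point of `S` (it would stay in `R`, forcing `c < c`).  For `R = univ` and a Cauchy time
function this is "a Cauchy time function is strictly monotonically increasing along any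
future-directed causal curve", Bär–Fredenhagen (eds.) 2009, Ch. 2, Cor. 2 (held text p0058), read
as acausality of its levels (O'Neill 1983, Ch. 14, p. 415; Lemma 14.42 for the spacelike
achronal case). [cite: ONeillSemiRiemannian1983, Ch. 14, p. 415] -/
theorem IsCausallyConvex.isAcausal_of_subset_level {R S : Set M} {t : M → ℝ} {c : ℝ}
    (hR : IsCausallyConvex g τ R) (ht : IsTimeFunctionOn g τ t R) (hS : S ⊆ R)
    (hc : ∀ p ∈ S, t p = c) : g.IsAcausal τ S := by
  intro p hp q hq γ a b hab hγ hpa hqb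
  have haR : γ a ∈ R := by rw [hpa]; exact hS hp
  have hbR : γ b ∈ R := by rw [hqb]; exact hS hq
  have hlt : t (γ a) < t (γ b) := ht γ a b hab hγ (hR γ a b hab hγ haR hbR)
  rw [hpa, hqb, hc p hp, hc q hq] at hlt
  exact lt_irrefl c hlt

/-- Levels of a GLOBAL time function (e.g. a Cauchy time / temporal function of a globally
hyperbolic development, Bernal–Sánchez 2005/2006) are acausal, and so is every subset of a level —
in particular a trapped sphere lying in a leaf of any Cauchy foliation.
[cite: ONeillSemiRiemannian1983, Ch. 14, p. 415] -/
theorem isAcausal_of_subset_level {S : Set M} {t : M → ℝ} {c : ℝ}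
    (ht : IsTimeFunctionOn g τ t univ) (hc : ∀ p ∈ S, t p = c) : g.IsAcausal τ S :=
  isCausallyConvex_univ.isAcausal_of_subset_level ht (subset_univ S) hc

/-- **RC-355-1 «SliceSide» (critic row 355), typed.**  If `t` is a time function on the open
subspacetime `I⁺(Σ)` only — e.g. a Cauchy temporal function OF `I⁺(Σ)` (globally hyperbolic in
its own right when the development is), whose level through an acausal compact spacelike
`T ⊂ I⁺(Σ)` is what Bernal–Sánchez 2006, Thm 1.1 (arXiv:gr-qc/0512095, held text p0002 L29–37)
delivers when applied inside `I⁺(Σ)` — then (with `A := Σ`) every `S ⊆ I⁺(Σ)` lying in ONE level of `t` is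
acausal in the whole development `M`: `I⁺(Σ)` is causally convex
(`isCausallyConvex_chronologicalFuture`), so a causal chord of `S` in `M` stays in `I⁺(Σ)` and is
seen by `t`.  So door E's reading `E_level` may take its slice to be a Cauchy slice of `I⁺(Σ)`
(sphere-side reading) with no loss: the produced trapped sphere is `IsAcausal` in `M` and lies in
`I⁺(Σ)`, as E (kernel v24 :4030) asks.  g43 addition. [cite: ONeillSemiRiemannian1983, Ch. 14, p. 415] -/
theorem isAcausal_of_subset_level_chronologicalFuture [BoundarylessManifold I M]
    [FiniteDimensional ℝ E] (hn : 1 ≤ n) {A S : Set M} {t : M → ℝ} {c : ℝ}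
    (ht : IsTimeFunctionOn g τ t (g.chronologicalFuture τ A))
    (hS : S ⊆ g.chronologicalFuture τ A) (hc : ∀ p ∈ S, t p = c) : g.IsAcausal τ S :=
  (isCausallyConvex_chronologicalFuture hn A).isAcausal_of_subset_level ht hS hc

/-- **Sub-level form for the fold census.**  If `R` is causally convex with a time function `t`,
then any `S ⊆ R` on which `t` is constant is acausal inside ANY causally convex `R' ⊇ S`
contained in `R` as well — restricting the region never creates causal chords (used in NODE-g42
§2(ii) for the Klainerman–Szeftel interior region `{r ≤ r₊(1 − δ_H/2)}`, on which `−r` is a time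
function, arXiv:2104.11857 §3, held text p0060 L67–86). [cite: ONeillSemiRiemannian1983, Ch. 14, p. 415] -/
theorem IsCausallyConvex.isAcausal_of_subset_level_inter {R R' S : Set M} {t : M → ℝ} {c : ℝ}
    (hR : IsCausallyConvex g τ R) (hR' : IsCausallyConvex g τ R') (ht : IsTimeFunctionOn g τ t R)
    (hS : S ⊆ R ∩ R') (hc : ∀ p ∈ S, t p = c) : g.IsAcausal τ S :=
  (hR.inter hR').isAcausal_of_subset_level (ht.mono inter_subset_left) hS hc

end CausallyConvex

/-! ## §2 The achronal core `T ∖ I⁺(T)` -/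

section AchronalCore

/-- The **achronal core** `T ∖ I⁺(T)` of a set `T`: the points of `T` with no point of `T` in
their chronological past.  (For a closed achronal `T` it is `T` itself,
`achronalCore_eq_self_iff`; it is the intersection of `T` with its future horismos
`E⁺(T) = J⁺(T) ∖ I⁺(T)`, Hawking–Ellis 1973, §4.5 / O'Neill 1983, Ch. 14, p. 403.)
[cite: ONeillSemiRiemannian1983, Ch. 14, p. 403 (horismos)] -/
def achronalCore (g : LorentzianMetric I n M) (τ : TimeOrientation g) (T : Set M) : Set M :=
  T \ g.chronologicalFuture τ T

variable {g : LorentzianMetric I n M} {τ : TimeOrientation g}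

/-- Membership in the achronal core: `a ∈ T` and `a ∉ I⁺(T)`. [cite: ONeillSemiRiemannian1983, Ch. 14, p. 403 (horismos)] -/
theorem mem_achronalCore_iff {T : Set M} {a : M} :
    a ∈ achronalCore g τ T ↔ a ∈ T ∧ a ∉ g.chronologicalFuture τ T :=
  Iff.rfl

/-- The achronal core of `T` is a subset of `T`. [cite: ONeillSemiRiemannian1983, Ch. 14, p. 403 (horismos)] -/
theorem achronalCore_subset (T : Set M) : achronalCore g τ T ⊆ T :=
  fun _ ha ↦ ha.1

/-- `achronalCore T ⊆ E⁺(T) = J⁺(T) ∖ I⁺(T)`. [cite: ONeillSemiRiemannian1983, Ch. 14, p. 403] -/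
theorem achronalCore_subset_causalFuture_diff (T : Set M) :
    achronalCore g τ T ⊆ g.causalFuture τ T \ g.chronologicalFuture τ T :=
  fun _ ha ↦ ⟨subset_causalFuture g τ T ha.1, ha.2⟩

/-- The achronal core is achronal (O'Neill 1983, Ch. 14, p. 413: `q ∉ I⁺(p)` for `p, q` in the
set), by monotonicity of `I⁺`. [cite: ONeillSemiRiemannian1983, Ch. 14, p. 413] -/
theorem isAchronal_achronalCore (T : Set M) : g.IsAchronal τ (achronalCore g τ T) := by
  intro p hp q hq hqp
  exact hq.2 (chronologicalFuture_mono (singleton_subset_iff.mpr hp.1) hqp)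

/-- `achronalCore T = T` iff `T` is achronal. [cite: ONeillSemiRiemannian1983, Ch. 14, p. 413] -/
theorem achronalCore_eq_self_iff {T : Set M} : achronalCore g τ T = T ↔ g.IsAchronal τ T := by
  constructor
  · intro h
    rw [← h]
    exact isAchronal_achronalCore T
  · intro hT
    refine Subset.antisymm (achronalCore_subset T) fun a ha ↦ ⟨ha, fun haI ↦ ?_⟩
    rw [chronologicalFuture_eq_biUnion] at haI
    simp only [mem_iUnion, exists_prop] at haI
    obtain ⟨b, hb, hab⟩ := haI
    exact hT b hb a ha hab

/-- The achronal core of a compact set is compact: `I⁺(T)` is open on a manifold without boundary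
(O'Neill 1983, Ch. 14, Lemma 14.3, tree `isOpen_chronologicalFuture_of_boundaryless`).
[cite: ONeillSemiRiemannian1983, Ch. 14, Lemma 14.3 (p. 403)] -/
theorem isCompact_achronalCore [BoundarylessManifold I M] {T : Set M} (hT : IsCompact T) :
    IsCompact (achronalCore g τ T) :=
  hT.diff (isOpen_chronologicalFuture_of_boundaryless g τ T)

/-- In a chronological spacetime the achronal core of a nonempty compact set is nonempty — a
restatement-free corollary of the tree's
`IsChronological.not_subset_chronologicalFuture_of_isCompact` (O'Neill 1983, Ch. 14, p. 407 with
Lemma 14.3). [cite: ONeillSemiRiemannian1983, Ch. 14, p. 407] -/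
theorem achronalCore_nonempty [BoundarylessManifold I M] (hc : g.IsChronological τ) {T : Set M}
    (hT : IsCompact T) (hne : T.Nonempty) : (achronalCore g τ T).Nonempty := by
  obtain ⟨a, haT, haI⟩ := not_subset.mp (hc.not_subset_chronologicalFuture_of_isCompact hT hne)
  exact ⟨a, haT, haI⟩

/-- **Minimal-element reduction.** In a globally hyperbolic spacetime, every point of `J⁺(T)`,
`T` compact, lies in `J⁺(a)` for some `a` in the achronal core of `T`.  Proof in the module
docstring (compactness of `T ∩ J⁻(x)`: O'Neill 1983, Ch. 14, Lemma 14.22; no compact `C ⊆ I⁺(C)`: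
p. 407; push-up: Cor. 14.1).  This is the causal-theoretic content of "the generator must have
past endpoint at `𝒯`" in Hawking–Ellis 1973, proof of Prop. 9.2.1 (held text p0311).
[cite: ONeillSemiRiemannian1983, Ch. 14, Lemma 14.22 (p. 412), Cor. 14.1 (p. 402), p. 407] -/
theorem exists_mem_achronalCore_of_mem_causalFuture [T2Space M] [BoundarylessManifold I M]
    [FiniteDimensional ℝ E] (hn : 1 ≤ n) (hG : g.IsGloballyHyperbolic τ) {T : Set M}
    (hT : IsCompact T) {x : M} (hx : x ∈ g.causalFuture τ T) :
    ∃ a ∈ achronalCore g τ T, x ∈ g.causalFuture τ {a} := by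
  have hCc : IsCompact (T ∩ g.causalPast τ {x}) :=
    hT.inter_right (hG.isClosed_causalPast_singleton x)
  have hx' : ∃ a ∈ T, x ∈ g.causalFuture τ {a} := by
    rw [causalFuture_eq_biUnion] at hx
    simpa only [mem_iUnion, exists_prop] using hx
  obtain ⟨a₀, ha₀T, hxa₀⟩ := hx'
  have hCne : (T ∩ g.causalPast τ {x}).Nonempty :=
    ⟨a₀, ha₀T, mem_causalPast_singleton_iff.mpr hxa₀⟩
  obtain ⟨a, ⟨haT, hax⟩, haI⟩ :=
    not_subset.mp (hG.1.isChronological.not_subset_chronologicalFuture_of_isCompact hCc hCne)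
  refine ⟨a, ⟨haT, fun haIT ↦ haI ?_⟩, mem_causalPast_singleton_iff.mp hax⟩
  -- `a ∈ I⁺(T)`: some `b ∈ T` has `b ≪ a ≤ x`, so `b ≪ x`, `b ∈ T ∩ J⁻(x)`, `a ∈ I⁺(T ∩ J⁻(x))`
  rw [chronologicalFuture_eq_biUnion] at haIT
  simp only [mem_iUnion, exists_prop] at haIT
  obtain ⟨b, hbT, hab⟩ := haIT
  have hxb : x ∈ g.chronologicalFuture τ {b} :=
    mem_chronologicalFuture_of_mem_chronologicalFuture_of_mem_causalFuture hn hab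
      (mem_causalPast_singleton_iff.mp hax)
  have hbC : b ∈ T ∩ g.causalPast τ {x} :=
    ⟨hbT, mem_causalPast_singleton_iff.mpr (chronologicalFuture_subset_causalFuture g τ {b} hxb)⟩
  exact chronologicalFuture_mono (singleton_subset_iff.mpr hbC) hab

/-- **`J⁺(achronalCore T) = J⁺(T)`** for compact `T` in a globally hyperbolic spacetime.
[cite: ONeillSemiRiemannian1983, Ch. 14, Lemma 14.22 (p. 412), Cor. 14.1 (p. 402), p. 407] -/
theorem causalFuture_achronalCore_eq [T2Space M] [BoundarylessManifold I M]
    [FiniteDimensional ℝ E] (hn : 1 ≤ n) (hG : g.IsGloballyHyperbolic τ) {T : Set M}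
    (hT : IsCompact T) : g.causalFuture τ (achronalCore g τ T) = g.causalFuture τ T := by
  refine Subset.antisymm (causalFuture_mono (achronalCore_subset T)) fun x hx ↦ ?_
  obtain ⟨a, ha, hxa⟩ := exists_mem_achronalCore_of_mem_causalFuture hn hG hT hx
  exact causalFuture_mono (singleton_subset_iff.mpr ha) hxa

/-- **`I⁺(achronalCore T) = I⁺(T)`** for compact `T` in a globally hyperbolic spacetime, from the
previous lemma and `I⁺(J⁺ S) = I⁺ S` (O'Neill 1983, Ch. 14, p. 403, tree
`chronologicalFuture_causalFuture_eq_of_boundaryless`).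
[cite: ONeillSemiRiemannian1983, Ch. 14, Cor. 14.1 and p. 403] -/
theorem chronologicalFuture_achronalCore_eq [T2Space M] [BoundarylessManifold I M]
    [FiniteDimensional ℝ E] (hn : 1 ≤ n) (hG : g.IsGloballyHyperbolic τ) {T : Set M}
    (hT : IsCompact T) :
    g.chronologicalFuture τ (achronalCore g τ T) = g.chronologicalFuture τ T := by
  rw [← chronologicalFuture_causalFuture_eq_of_boundaryless hn (achronalCore g τ T),
    causalFuture_achronalCore_eq hn hG hT, chronologicalFuture_causalFuture_eq_of_boundaryless hn T]

/-- **`E⁺(achronalCore T) = E⁺(T)`**: the future horismos (hence the achronal boundary `∂J⁺` and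
future-trappedness in the sense of Hawking–Ellis 1973, §8.2 / O'Neill 1983, Def. 14.59) of a
compact set is that of its compact ACHRONAL core — O'Neill's achronality hypothesis in Def. 14.59
/ Thm. 14.61 is free for compact sets. [cite: ONeillSemiRiemannian1983, Ch. 14, Def. 14.59 and Thm. 14.61 (pp. 435–437)] -/
theorem causalFuture_diff_chronologicalFuture_achronalCore_eq [T2Space M] [BoundarylessManifold I M]
    [FiniteDimensional ℝ E] (hn : 1 ≤ n) (hG : g.IsGloballyHyperbolic τ) {T : Set M}
    (hT : IsCompact T) :
    g.causalFuture τ (achronalCore g τ T) \ g.chronologicalFuture τ (achronalCore g τ T) =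
      g.causalFuture τ T \ g.chronologicalFuture τ T := by
  rw [causalFuture_achronalCore_eq hn hG hT, chronologicalFuture_achronalCore_eq hn hG hT]

end AchronalCore

/-! ## §3 The past Cauchy horizon `H⁻(A)` and the causal sealing of `int D⁻(A)` -/

section PastCauchyHorizon

/-- The **past Cauchy horizon** `H⁻(A) := closure D⁻(A) ∖ I⁺(D⁻(A))` of a set `A ⊆ M` — the time
dual of Hawking–Ellis' `H⁺(S) = closure D⁺(S) − I⁻(D⁺(S))` (Hawking–Ellis 1973, §6.5, definition
preceding Prop. 6.5.2; held text p0189 L7).  Stated with the tree's `pastCauchyDevelopment` and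
`chronologicalFuture`. [cite: HawkingEllis1973, §6.5 (definition of the Cauchy horizon, time dual)] -/
def pastCauchyHorizon (g : LorentzianMetric I n M) (τ : TimeOrientation g) (A : Set M) : Set M :=
  closure (g.pastCauchyDevelopment τ A) \ g.chronologicalFuture τ (g.pastCauchyDevelopment τ A)

variable {g : LorentzianMetric I n M} {τ : TimeOrientation g}

/-- **`J⁺(int D) ⊆ I⁺(D)`** for every set `D`: if `p ∈ int D` and `p ≤ q`, pick `p' ∈ int D` with
`p' ≪ p` (possible since `p ∈ closure I⁻(p)`, `LorentzianMetric.mem_closure_chronologicalFuture_self`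
for the reversed time orientation, and `int D` is a neighbourhood of `p`); then `p' ≪ p ≤ q` gives
`p' ≪ q` by push-up (O'Neill 1983, Ch. 14, Cor. 14.1, tree:
`LorentzianMetric.mem_chronologicalFuture_of_mem_chronologicalFuture_of_mem_causalFuture`), so
`q ∈ I⁺(D)`.  This is the elementary half of Hawking–Ellis 1973, Prop. 6.5.2 / Prop. 6.6.3 Cor.
(`int D(S) = D(S) − (H⁺ ∪ H⁻)`, held text p0196 L7). [cite: ONeillSemiRiemannian1983, Ch. 14, Cor. 14.1 (p. 402)] -/
theorem causalFuture_interior_subset_chronologicalFuture [BoundarylessManifold I M]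
    [FiniteDimensional ℝ E] (hn : 1 ≤ n) (D : Set M) :
    g.causalFuture τ (interior D) ⊆ g.chronologicalFuture τ D := by
  intro q hq
  rw [LorentzianMetric.causalFuture_eq_biUnion] at hq
  simp only [mem_iUnion, exists_prop] at hq
  obtain ⟨p, hp, hqp⟩ := hq
  have hcl : p ∈ closure (g.chronologicalPast τ {p}) :=
    g.mem_closure_chronologicalFuture_self τ.reverse BoundarylessManifold.isInteriorPoint
  obtain ⟨p', hp'D, hp'p⟩ :=
    mem_closure_iff_nhds.mp hcl (interior D) (isOpen_interior.mem_nhds hp)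
  have hpp' : p ∈ g.chronologicalFuture τ {p'} :=
    LorentzianMetric.mem_chronologicalFuture_of_mem_chronologicalPast hp'p
  exact LorentzianMetric.chronologicalFuture_mono (singleton_subset_iff.mpr (interior_subset hp'D))
    (LorentzianMetric.mem_chronologicalFuture_of_mem_chronologicalFuture_of_mem_causalFuture
      hn hpp' hqp)

/-- **Causal sealing of the past Cauchy horizon from the inside**: `J⁺(int D⁻(A))` is disjoint
from `H⁻(A) = closure D⁻(A) ∖ I⁺(D⁻(A))`, because `J⁺(int D⁻(A)) ⊆ I⁺(D⁻(A))`
(`causalFuture_interior_subset_chronologicalFuture`).  Time dual of the containment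
`H⁺(S) ∩ I⁻(D⁺(S))ᶜ`-reading of Hawking–Ellis 1973, §6.5 (definition of `H⁺`, p0189 L7) combined
with Prop. 6.6.3 Cor. (p0196 L7). [cite: HawkingEllis1973, §6.5–6.6 (Prop. 6.5.2, Prop. 6.6.3 Cor.)] -/
theorem disjoint_causalFuture_interior_pastCauchyHorizon [BoundarylessManifold I M]
    [FiniteDimensional ℝ E] (hn : 1 ≤ n) (A : Set M) :
    Disjoint (g.causalFuture τ (interior (g.pastCauchyDevelopment τ A)))
      (pastCauchyHorizon g τ A) := by
  unfold pastCauchyHorizon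
  exact Set.disjoint_left.mpr fun q hq hH ↦
    hH.2 (causalFuture_interior_subset_chronologicalFuture hn _ hq)

/-- **(U3) of NODE-g40 §2, the form used for the collar slab**: a seed `S ⊆ int D⁻(A)` has
`J⁺(S) ∩ H⁻(A) = ∅` — the evolved region never reaches the null lateral boundary
`N ⊆ H⁻(A)` of the collar, whatever the slab height; this is what replaces the timelike tube
`∂M × I` of Andersson–Mars–Metzger–Simon 2009, Thm. 3.1 (arXiv:0811.4721, setting p0003
L146–p0004 L13, proof p0005 L66–96). [cite: AnderssonMarsMetzgerSimon2009, Thm. 3.1 (arXiv:0811.4721 p0005 L66–96)] -/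
theorem causalFuture_inter_pastCauchyHorizon_eq_empty [BoundarylessManifold I M]
    [FiniteDimensional ℝ E] (hn : 1 ≤ n) {A S : Set M}
    (hS : S ⊆ interior (g.pastCauchyDevelopment τ A)) :
    g.causalFuture τ S ∩ pastCauchyHorizon g τ A = ∅ :=
  Set.disjoint_iff_inter_eq_empty.mp
    ((disjoint_causalFuture_interior_pastCauchyHorizon hn A).mono_left
      (LorentzianMetric.causalFuture_mono hS))

/-- **Step (C1) of RC-339-2**: a point `z` in the causal past of a horizon point `y ∈ H⁻(A)`
(`y ∈ J⁺(z)`) is not in `I⁺(D⁻(A))` — otherwise `z ≪ · ≤ y` would put `y ∈ I⁺(D⁻(A))` by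
push-up (set form, tree:
`LorentzianMetric.mem_chronologicalFuture_of_mem_chronologicalFuture_of_mem_causalFuture_set`),
contradicting `y ∈ H⁻(A)`.  In (m2′): `γ_x(s) ≤ x ∈ S_R ⊆ H⁻(M_R)` ⇒ `γ_x(s) ∉ I⁺(D⁻(M_R))`.
[cite: ONeillSemiRiemannian1983, Ch. 14, Cor. 14.1 (p. 402)] -/
theorem not_mem_chronologicalFuture_pastCauchyDevelopment_of_le_horizon [BoundarylessManifold I M]
    [FiniteDimensional ℝ E] (hn : 1 ≤ n) {A : Set M} {y z : M}
    (hy : y ∈ pastCauchyHorizon g τ A) (hyz : y ∈ g.causalFuture τ {z}) :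
    z ∉ g.chronologicalFuture τ (g.pastCauchyDevelopment τ A) := by
  unfold pastCauchyHorizon at hy
  exact fun hz ↦ hy.2
    (LorentzianMetric.mem_chronologicalFuture_of_mem_chronologicalFuture_of_mem_causalFuture_set
      hn hz hyz)

end PastCauchyHorizon

end LorentzianMetric

end Literature.Geometry.Lorentzian

end
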